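import Literature.NumberTheory.Transcendental.DiazLadderHolds
import Literature.NumberTheory.Transcendental.DiazLadderProofs
import HarnessLib

/-!
# Discharges of named facts of `GelfondDiaz.lean`

`Literature/NumberTheory/Transcendental/GelfondDiazHolds.lean` — proofs-only sibling of
`GelfondDiaz.lean` (no definitions, no named facts). Each theorem below closes a named fact `X
: Prop` of that file as `X_holds : X` by composing an ACCEPTED reduction theorem of the tree
with the ACCEPTED unconditional `_holds` discharges of all of its hypotheses; nothing is
re-proved and no statement is changed. Recorded by the librarian sweep g25 (2026-08-16, pass
5c: facts dischargeable in one line from the tree's own lemmas), so that the facts census,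
`#h21_route_deps` and the cone guardrail see these facts as theorems.

Discharged here:

* `Diaz1989_holds` := `periods_Diaz1989_of_diaz_1989` `diaz_1989_holds`
  (`DiazLadderProofs.lean`).

## References

* [Diaz1989] — see `lean/references.bib` and the docstring of the fact in `GelfondDiaz.lean`.
* [Laurent1991] — see `lean/references.bib` and the docstring of the fact in `GelfondDiaz.lean`.
-/

namespace Literature.NumberTheory.Transcendental

/-- **Discharge of the named fact `Diaz1989`** (`GelfondDiaz.lean`): Diaz's theorem (Diaz 1989,
main theorem; Laurent 1991, §3.1, Corollaire ). Let `a ∈ ℂ` be algebraic and `l` a nonzero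
determination of `log a` (`cexp l = a`, `l ≠ 0`; … — obtained as
`periods_Diaz1989_of_diaz_1989` applied to the tree's unconditional discharge
`diaz_1989_holds` of its hypothesis (reduction in `DiazLadderProofs.lean`).
[cite: Laurent1991, §3.1 Corollaire]
[cite: Diaz1989, main theorem (Théorème 1)] -/
theorem Diaz1989_holds :
    Diaz1989 :=
  periods_Diaz1989_of_diaz_1989 diaz_1989_holds

end Literature.NumberTheory.Transcendental
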